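import Summits.QuantumFields.YangMills.Theorems.BalabanUVNodesN07Thm1ScaledInterfaceInstance
import Summits.QuantumFields.YangMills.Theorems.BalabanUVNodesN07DirectMethodDetSet
import Literature.MathematicalPhysics.QuantumFieldTheory.Balaban1983to89.Node00.Record12BgRowMixed
import Literature.MathematicalPhysics.QuantumFieldTheory.Balaban1983to89.B8Eq110UnitaryProof
import Literature.MathematicalPhysics.QuantumFieldTheory.Balaban1983to89.TorusHypercubicSymmetry
import HarnessLib

/-!
# BalabanUVNodes ∕ N07 ([Balaban1985Variational] Theorem 1 (8) p. 279; [Balaban1988Convergent] (2.12) p. 256) — SMALL-ACTION BOUNDARY AVOIDANCE: the (2.12)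
# variational problem over print's OPEN multi-scale class HAS a minimal configuration whenever its fibre holds an element of the open class whose Wilson action
# is below one boundary plaquette (`2N·A < (ε₀η_k²)²`); plus the single-bond ∕ corner-plaquette bookkeeping used by the corner-at-level-0 certificate
# (companion `…N07Thm1CornerLevelZeroObstruction`)

Track A of `YM-PLAN.md` (cell `pub-ymgap`, HUMAN RULING D-0062), DAG node **N07** = [15] = [Balaban1985Variational]; seat `pub-ymgap-dag-n07-e`, generation 7,
INTENT-19 INBOX l.17307 (director-ym №142 (S2) HYP-AUDIT-13 witness); `--kind proof --supports stmt-QuantumFields-20289 --as helper`.  THEOREMS ONLY (0 `def`,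
0 `sorry`, 0 `instance`); nothing imported is modified.  Companions: 13 `…N07DirectMethodDetSet` (the direct method over CLOSED classes, whose displayed
«interiority of closed-class minimisers» this file DISCHARGES in the small-action regime), 11a `…N07DirectMethod`, 17a `…N07Thm1ScaledInterfaceInstance`.

CONTENT.  §1 (generic, any torus, `SU(N)`): `one_sub_reTr_plaqHol_le_wilsonAction4` (one plaquette term ≤ the action), `dist1_plaqHol_sq_le_wilsonAction4`
(`|U(∂q) − 1|² ≤ 2N·A(U)`, [6] (1.10) via `B8Eq110UnitaryProof.cmp'_specialUnitaryGroup`), `dist1_plaqHol_lt_of_wilsonAction4_lt` (small action ⇒ every plaquette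
strictly inside), `wilsonAction4_le_card_mul_sq` (`A ≤ #Plaq·t²`, `cmp_specialUnitaryGroup`), `eta_sq_le_eta_sq_of_le`; ★★ `exists_isMinimizer_holes_of_smallAction`:
on `F.P K`, for the class `C(ε₀) = {U | ∀ n ≤ k, PlaqSmallOn (omegaPlaqs Ω n) (ε₀η_n²) U}` (`Ω₀ = T_η`), `0 ≤ ε₀ < α₀η_k²` with `α₀` (53)-admissible (module 13's
continuity regime), determining set `genSet Ω k`, data `W`: a fibre element `U₁ ∈ C(ε₀)` with `2N·A(U₁) < (ε₀η_k²)²` ⇒ `∃ U₀, IsMinimizer (avOfRecord F N K) C(ε₀)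
(genSet Ω k) W U₀` — the direct method over `closure C(ε₀)` (module 13 `exists_isMinimizer_of_isClosed`) and then `dist1² ≤ 2N·A(U_c) ≤ 2N·A(U₁) < (ε₀η_k²)²`
puts the closed-class minimiser in the OPEN class.  §2 (generic bookkeeping; `Site.shift_comm` from `TorusHypercubicSymmetry`): `plaqHol_single_eq_one_of_targets`,
`plaqHol_single_eq_one_of_plaqInside_compl` (the single-bond datum at a bond ENTERING `D` is trivial on every plaquette inside `Dᶜ` — the level-0 range
`plaqInside Γ₀` of node00-def-P11's `Sect2.DataSmall7` is blind to it), `plaqHol_single_corner` (the corner plaquette reads it: holonomy `h⁻¹`),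
`mixedField_avg_self` (the (7) mixed field of an AVERAGED family is the averaged field), `cornerPlaq_bonds_mem_bondsOf` (all four bonds of the corner plaquette
lie in `bondsOf Γ₀` — the print-exact level-0 range of [15] (7), «(∂V)(p′) = V(∂p′)» with no `V̄`, READS it), `outerPlaqs_zero_subset_plaqInside` (FILE 8 v1.2's
«outer» range is `plaqInside Γ₀` again at level 0, `k ≥ 1`).

HONEST FRAMING.  Kernel theorems about the tree's own objects (compactness + continuity from modules 11a∕13 + one action comparison); the existence theorem is
VOLUME-DEPENDENT through its hypothesis `2N·A(U₁) < (ε₀η_k²)²` — NOT Bałaban's uniform existence statement, which is NOT asserted; K0⁗ ∕ N07 NOT discharged;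
COUNT-NEUTRAL; one finite four-torus programme at fixed `ε = L^{−K}` — NOT continuum ∕ ℝ⁴ ∕ OS ∕ mass gap ∕ Clay.  No `instance`, no notation, 0 kit.
[Sources: Balaban1985Variational Thm 1 (7)–(8) pp.278–279; Balaban1988Convergent (2.2), (2.10)–(2.12) pp.255–256; Balaban1985RegularSpaces (1.10) p.77;
Balaban1987RG1 (0.2) p.252, (1.1) p.260.]
-/

noncomputable section

namespace Summit.QuantumFields.YangMills.BalabanUVNodes.N07SmallActionBoundaryAvoidance

open Set
open Literature.MathematicalPhysics.QuantumFieldTheory.Balaban1983to89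
open Literature.MathematicalPhysics.QuantumFieldTheory.Balaban1983to89.T4Continuum (T4Family)
open Literature.MathematicalPhysics.QuantumFieldTheory.Balaban1983to89.Node00
open Literature.MathematicalPhysics.QuantumFieldTheory.Balaban1983to89.B15DeterminingSets
open Summit.QuantumFields.YangMills.BalabanUVNodes.N07Thm1ScaledInterfaceInstance
open Summit.QuantumFields.YangMills.BalabanUVNodes.N07DirectMethod (closure_plaqSmall_subset_plaqSmall)
open Summit.QuantumFields.YangMills.BalabanUVNodes.N07DirectMethodDetSet (exists_isMinimizer_of_isClosed
  isMinimizer_of_isMinimizer_closure_of_mem)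
open BlockAveraging (avgFun)
open B8Eq110UnitaryProof (cmp_specialUnitaryGroup cmp'_specialUnitaryGroup)
open ExpMeanLog (expMeanLogSU deltaSU deltaSU_pos)
open scoped Matrix.Norms.L2Operator

/-! ## §1  Small-action boundary avoidance: an open-class (2.12) minimiser from a small-action fibre element -/

section SmallAction

variable {P : Params} {j : ℕ} {N : ℕ} [NeZero N]

/-- One plaquette term of the Wilson action is at most the whole action (all terms are `≥ 0`). [cite: Balaban1987RG1, (0.2) p.252 (bookkeeping)] -/
theorem one_sub_reTr_plaqHol_le_wilsonAction4 (U : GaugeField P j (SU N)) (q : Plaq P j) :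
    1 - reTr (GaugeField.plaqHol U q) ≤ wilsonAction4 U := by
  unfold wilsonAction4 wilsonAction
  have h := Finset.single_le_sum (s := (Finset.univ : Finset (Plaq P j)))
    (f := fun p : Plaq P j => (1 : ℝ) * (1 - reTr (GaugeField.plaqHol U p)))
    (fun p _ => by have := GaugeGroup.reTr_le_one (GaugeField.plaqHol U p); linarith) (Finset.mem_univ q)
  simpa only [one_mul] using h

/-- `|U(∂q) − 1|² ≤ 2N·A(U)` for every plaquette `q` ([6] (1.10): `dist1² ≤ 2N(1 − reTr)` on `SU(N)`). [cite: Balaban1985RegularSpaces, (1.10) p.77] -/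
theorem dist1_plaqHol_sq_le_wilsonAction4 (U : GaugeField P j (SU N)) (q : Plaq P j) :
    dist1 (GaugeField.plaqHol U q) ^ 2 ≤ 2 * N * wilsonAction4 U := by
  have h1 := cmp'_specialUnitaryGroup (n := Fin N) (GaugeField.plaqHol U q)
  rw [Fintype.card_fin] at h1
  have h2 := one_sub_reTr_plaqHol_le_wilsonAction4 U q
  have hN : (0 : ℝ) ≤ 2 * N := by positivity
  exact h1.trans (mul_le_mul_of_nonneg_left h2 hN)

/-- **SMALL ACTION ⇒ EVERY PLAQUETTE STRICTLY INSIDE**: if `2N·A(U) < r²` (`r ≥ 0`) then `|U(∂q) − 1| < r` for every plaquette `q`.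
[cite: Balaban1985RegularSpaces, (1.10) p.77; Balaban1985Variational, (2) p.278] -/
theorem dist1_plaqHol_lt_of_wilsonAction4_lt {U : GaugeField P j (SU N)} {r : ℝ} (hr : 0 ≤ r) (h : 2 * N * wilsonAction4 U < r ^ 2)
    (q : Plaq P j) : dist1 (GaugeField.plaqHol U q) < r :=
  lt_of_pow_lt_pow_left₀ 2 hr ((dist1_plaqHol_sq_le_wilsonAction4 U q).trans_lt h)

/-- `A(U) ≤ #Plaq · t²` when every plaquette of `U` is within `t` of `1` ([6] (1.10): `1 − reTr ≤ dist1²`). [cite: Balaban1985RegularSpaces, (1.10) p.77] -/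
theorem wilsonAction4_le_card_mul_sq {U : GaugeField P j (SU N)} {t : ℝ} (hU : ∀ q : Plaq P j, dist1 (GaugeField.plaqHol U q) ≤ t) :
    wilsonAction4 U ≤ (Fintype.card (Plaq P j) : ℝ) * t ^ 2 := by
  unfold wilsonAction4 wilsonAction
  calc ∑ p : Plaq P j, (1 : ℝ) * (1 - reTr (GaugeField.plaqHol U p)) ≤ ∑ _p : Plaq P j, t ^ 2 :=
        Finset.sum_le_sum fun p _ => by
          rw [one_mul]
          have h1 := cmp_specialUnitaryGroup (n := Fin N) (GaugeField.plaqHol U p)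
          exact h1.trans (pow_le_pow_left₀ (GaugeGroup.dist1_nonneg _) (hU p) 2)
    _ = (Fintype.card (Plaq P j) : ℝ) * t ^ 2 := by rw [Finset.sum_const, Finset.card_univ, nsmul_eq_mul]

/-- `η_k² ≤ η_n²` for `n ≤ k` (`η_j = L^{−j}`, `L ≥ 1`). [cite: Balaban1987RG1, (1.1) p.260 (bookkeeping)] -/
theorem eta_sq_le_eta_sq_of_le {n k : ℕ} (hnk : n ≤ k) : P.eta k ^ 2 ≤ P.eta n ^ 2 := by
  have hL : (1 : ℝ) ≤ P.L := by exact_mod_cast P.L_pos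
  have h0 : (0 : ℝ) ≤ (P.L : ℝ)⁻¹ := inv_nonneg.mpr (by linarith)
  have h1 : (P.L : ℝ)⁻¹ ≤ 1 := inv_le_one_of_one_le₀ hL
  have h : P.eta k ≤ P.eta n := pow_le_pow_of_le_one h0 h1 hnk
  exact pow_le_pow_left₀ (pow_nonneg h0 k) h 2

end SmallAction

section Existence

variable (F : T4Family) {N : ℕ} [NeZero N]

/-- ★★ **SMALL-ACTION BOUNDARY AVOIDANCE — AN OPEN-CLASS (2.12) MINIMISER EXISTS.**  On the torus `F.P K`, for print's multi-scale class
`C(ε₀) = {U | ∀ n ≤ k, |U(∂q) − 1| < ε₀η_n² on the plaquettes «q ∈ Ω_n»}` (`Ω₀ = T_η`) with `0 ≤ ε₀ < α₀η_k²`, `α₀` (53)-admissible (so that the averagings of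
record are continuous on the closure — module 13), the determining set `genSet Ω k` and data `W`: if the fibre `{M_𝔅(U) = W}` holds an element `U₁ ∈ C(ε₀)`
with `2N·A(U₁) < (ε₀η_k²)²`, then (2.12) over the OPEN class `C(ε₀)` HAS a minimal configuration.  Proof: the direct method over the CLOSED class
`closure C(ε₀)` (module 13 `exists_isMinimizer_of_isClosed`) gives `U_c` with `A(U_c) ≤ A(U₁)`; then every plaquette of `U_c` has `dist1² ≤ 2N·A(U_c) <
(ε₀η_k²)²`, so `U_c ∈ C(ε₀)` and it minimises over `C(ε₀) ⊆ closure C(ε₀)`.  Volume-dependent (through the hypothesis), NOT Bałaban's uniform statement.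
[cite: Balaban1985Variational, Thm 1 (8) p.279; Balaban1988Convergent, (2.12) p.256; Balaban1985RegularSpaces, (1.10) p.77] -/
theorem exists_isMinimizer_holes_of_smallAction (K k : ℕ) (Ω : ℕ → Set (Site (F.P K) 0)) {α₀ ε₀ : ℝ} (hα : 0 < α₀)
    (hα3 : (143 * (((((F.P K).d + 4 : ℕ) : ℝ)) ^ 2 / 4) ^ 2) * α₀ ≤ 1 / 3)
    (hα2 : 2 * α₀ ≤ 2 * deltaSU (Fin N) / ((((F.P K).d + 4) * (F.P K).L : ℕ) : ℝ) ^ 2)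
    (hε0 : 0 ≤ ε₀) (hε : ε₀ < α₀ * (F.P K).eta k ^ 2)
    {W : MSField (F.P K) (SU N)} {U₁ : GaugeField (F.P K) 0 (SU N)}
    (hU₁ : ∀ n, n ≤ k → PlaqSmallOn (omegaPlaqs Ω n) (ε₀ * (F.P K).eta n ^ 2) U₁)
    (hA : AgreeOn (genSet Ω k) (avgFamily (avOfRecord F N K) U₁) W)
    (hact : 2 * N * wilsonAction4 U₁ < (ε₀ * (F.P K).eta k ^ 2) ^ 2) :
    ∃ U₀ : GaugeField (F.P K) 0 (SU N),
      IsMinimizer (avOfRecord F N K) {U | ∀ n, n ≤ k → PlaqSmallOn (omegaPlaqs Ω n) (ε₀ * (F.P K).eta n ^ 2) U} (genSet Ω k) W U₀ := by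
  set reg₀ : Set (GaugeField (F.P K) 0 (SU N)) :=
    {U | ∀ n, n ≤ k → PlaqSmallOn (omegaPlaqs Ω n) (ε₀ * (F.P K).eta n ^ 2) U} with hreg₀
  -- the open class lies in `{PlaqSmall ε₀}` (its scale-0 clause), whose closure lies in `bgReg F N K k α₀`
  have hsub0 : reg₀ ⊆ {U | PlaqSmall ε₀ U} := by
    intro U hU q
    have h := hU 0 (Nat.zero_le _) q (by rw [omegaPlaqs_zero]; exact Set.mem_univ q)
    simpa [Params.eta] using h
  have hsub : closure reg₀ ⊆ bgReg F N K k α₀ :=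
    (closure_mono hsub0).trans (closure_plaqSmall_subset_plaqSmall hε)
  have h𝔹 : ∀ j, k < j → genSet Ω k j = ∅ := by
    intro j hj
    show pts j (gammaRegion Ω k j) = ∅
    rw [gammaRegion_of_gt Ω hj]
    rfl
  obtain ⟨U₀, hmin⟩ := exists_isMinimizer_of_isClosed K k hα hα3 hα2 isClosed_closure hsub (genSet Ω k) h𝔹
    ⟨U₁, subset_closure hU₁, hA⟩
  -- boundary avoidance: `A(U₀) ≤ A(U₁)` is below one boundary plaquette
  have hAct : wilsonAction4 U₀ ≤ wilsonAction4 U₁ := hmin.2.2 U₁ (subset_closure hU₁) hA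
  have hr : 0 ≤ ε₀ * (F.P K).eta k ^ 2 := mul_nonneg hε0 (sq_nonneg _)
  have hN : (0 : ℝ) ≤ 2 * N := by positivity
  have hlt : 2 * N * wilsonAction4 U₀ < (ε₀ * (F.P K).eta k ^ 2) ^ 2 :=
    (mul_le_mul_of_nonneg_left hAct hN).trans_lt hact
  have hmem : U₀ ∈ reg₀ := by
    intro n hn q _
    exact (dist1_plaqHol_lt_of_wilsonAction4_lt hr hlt q).trans_le
      (mul_le_mul_of_nonneg_left (eta_sq_le_eta_sq_of_le hn) hε0)
  exact ⟨U₀, isMinimizer_of_isMinimizer_closure_of_mem hmin hmem⟩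

end Existence

/-! ## §2  The single-bond datum, the plaquettes inside `Γ₀`, the corner plaquette, and the mixed field of an averaged family -/

section Datum

variable {P : Params} {j : ℕ} {G : Type*} [GaugeGroup G]

/-- **The single-bond datum at `⟨x′, μ₀⟩` is `1` on every plaquette none of whose four bond-TARGETS is `x′ + e_{μ₀}`.** [folklore] -/
theorem plaqHol_single_eq_one_of_targets (x' : Site P j) (μ0 : Fin P.d) (h : G) (q : Plaq P j)
    (h1 : q.src.shift q.μ ≠ x'.shift μ0) (h2 : (q.src.shift q.μ).shift q.ν ≠ x'.shift μ0)
    (h3 : (q.src.shift q.ν).shift q.μ ≠ x'.shift μ0) (h4 : q.src.shift q.ν ≠ x'.shift μ0) :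
    GaugeField.plaqHol (fun b : PBond P j => if b.src = x' ∧ b.dir = μ0 then h else 1) q = 1 := by
  have key : ∀ (y : Site P j) (μ : Fin P.d), y.shift μ ≠ x'.shift μ0 → ¬ (y = x' ∧ μ = μ0) := by
    rintro y μ hne ⟨rfl, rfl⟩
    exact hne rfl
  show (if q.src = x' ∧ q.μ = μ0 then h else 1) * (if q.src.shift q.μ = x' ∧ q.ν = μ0 then h else 1) *
      (if q.src.shift q.ν = x' ∧ q.μ = μ0 then h else 1)⁻¹ * (if q.src = x' ∧ q.ν = μ0 then h else 1)⁻¹ = 1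
  rw [if_neg (key _ _ h1), if_neg (key _ _ h2), if_neg (key _ _ h3), if_neg (key _ _ h4)]
  simp

/-- **THE LEVEL-0 CLAUSE OF THE TYPED (7) IS BLIND TO A BOND ENTERING `Ω₁`**: if `x′ + e_{μ₀} ∈ D` then the single-bond datum at `⟨x′, μ₀⟩` has holonomy `1`
on every plaquette INSIDE `Dᶜ` (all four corners off `D` ⇒ all four bond-targets off `D`). [cite: Balaban1985Variational, (7) p.278 («p′ ⊂ Λ_j»)] -/
theorem plaqHol_single_eq_one_of_plaqInside_compl {D : Set (Site P 0)} {x' : Site P 0} {μ0 : Fin P.d} (hx : x'.shift μ0 ∈ D) (h : G)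
    {q : Plaq P 0} (hq : q ∈ plaqInside Dᶜ) :
    GaugeField.plaqHol (fun b : PBond P 0 => if b.src = x' ∧ b.dir = μ0 then h else 1) q = 1 := by
  obtain ⟨-, h2, h3, h4⟩ := hq
  refine plaqHol_single_eq_one_of_targets x' μ0 h q ?_ ?_ ?_ ?_
  · intro hc; exact h2 (hc ▸ hx)
  · intro hc; exact h4 (hc ▸ hx)
  · intro hc; rw [Site.shift_comm] at hc; exact h4 (hc ▸ hx)
  · intro hc; exact h3 (hc ▸ hx)

/-- **The corner plaquette reads the twisted bond**: the single-bond datum at `⟨x + e_{μ₁}, μ₀⟩` has holonomy `h⁻¹` on `p = ⟨x; μ₀, μ₁⟩`. [folklore] -/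
theorem plaqHol_single_corner (p : Plaq P j) (h : G) :
    GaugeField.plaqHol (fun b : PBond P j => if b.src = p.src.shift p.ν ∧ b.dir = p.μ then h else 1) p = h⁻¹ := by
  have hne : p.ν ≠ p.μ := ne_of_gt p.hμν
  have hx : p.src ≠ p.src.shift p.ν := fun hc => T4WilsonLinkAffine.shift_ne_self p.src p.ν hc.symm
  show (if p.src = p.src.shift p.ν ∧ p.μ = p.μ then h else 1) * (if p.src.shift p.μ = p.src.shift p.ν ∧ p.ν = p.μ then h else 1) *
      (if p.src.shift p.ν = p.src.shift p.ν ∧ p.μ = p.μ then h else 1)⁻¹ * (if p.src = p.src.shift p.ν ∧ p.ν = p.μ then h else 1)⁻¹ = h⁻¹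
  rw [if_neg (fun hc => hx hc.1), if_neg (fun hc => hne hc.2), if_pos ⟨rfl, rfl⟩, if_neg (fun hc => hne hc.2)]
  simp

/-- **The mixed field of an AVERAGED family is the averaged field**: with `W_{m+1} = M(W_m)` both branches of print's (7) field coincide.
[cite: Balaban1985Variational, (7) p.278 (bookkeeping)] -/
theorem mixedField_avg_self (av : ∀ i, Averaging P i G) {m : ℕ} (S : Set (Site P (m + 1))) (Wm : GaugeField P m G) :
    Sect2.mixedField av S ((av m).avg Wm) Wm = (av m).avg Wm := by
  funext b
  unfold Sect2.mixedField
  split_ifs <;> rfl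

/-- **THE PRINT-EXACT LEVEL-0 RANGE READS THE CORNER PLAQUETTE**: for `k ≥ 1`, a fine plaquette whose three near corners lie outside `Ω₁` has ALL FOUR bonds in
`bondsOf (genSet Ω k 0)` (each is sourced in `Γ₀ = Ω₁ᶜ`) — so a level-0 clause over «plaquettes whose bonds all belong to Λ₀» (p. 278: `(∂V)(p′) = V(∂p′)`,
no `V̄` needed) constrains it, whereas `plaqInside Γ₀` does not when its far corner lies in `Ω₁`. [cite: Balaban1985Variational, (7) p.278; Balaban1988Convergent, (2.2) p.255] -/
theorem cornerPlaq_bonds_mem_bondsOf {k : ℕ} (hk : 0 < k) (Ω : ℕ → Set (Site P 0)) (p : Plaq P 0)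
    (h1 : p.src ∉ Ω 1) (h2 : p.src.shift p.μ ∉ Ω 1) (h3 : p.src.shift p.ν ∉ Ω 1) :
    (⟨p.src, p.μ⟩ : PBond P 0) ∈ bondsOf (genSet Ω k 0) ∧ (⟨p.src.shift p.μ, p.ν⟩ : PBond P 0) ∈ bondsOf (genSet Ω k 0) ∧
      (⟨p.src.shift p.ν, p.μ⟩ : PBond P 0) ∈ bondsOf (genSet Ω k 0) ∧ (⟨p.src, p.ν⟩ : PBond P 0) ∈ bondsOf (genSet Ω k 0) := by
  have hb : ∀ b : PBond P 0, b.src ∉ Ω 1 → b ∈ bondsOf (genSet Ω k 0) := by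
    intro b hb
    show b ∈ bondsOf (pts 0 (gammaRegion Ω k 0))
    rw [gammaRegion_zero Ω hk, pts_zero]
    exact Or.inl hb
  exact ⟨hb _ h1, hb _ h2, hb _ h3, hb _ h1⟩

/-- **AT LEVEL 0 THE v1.2 «OUTER» RANGE IS `plaqInside Γ₀` AGAIN** (for `k ≥ 1`): a level-0 plaquette none of whose corners lies in `Ω₁` has all four corners in
`Γ₀ = Ω₁ᶜ = genSet Ω k 0` — so `Sect2.DataSmall7Outer` (FILE 8 v1.2, p507143) inherits the level-0 blindness of `Sect2.DataSmall7` on every sequence with `k ≥ 1`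
(dag-n21-c g7 INBOX l.17386 (III)(a), by hand; here in kernel). [cite: Balaban1985Variational, (7) p.278; Balaban1988Convergent, (2.2) p.255 (bookkeeping)] -/
theorem outerPlaqs_zero_subset_plaqInside (Ω : ℕ → Set (Site P 0)) {k : ℕ} (hk : 0 < k) :
    Sect2.outerPlaqs Ω k 0 ⊆ plaqInside (genSet Ω k 0) := by
  rintro q ⟨-, h1, h2, h3, h4⟩
  show q ∈ plaqInside (pts 0 (gammaRegion Ω k 0))
  rw [gammaRegion_zero Ω hk, pts_zero]
  exact ⟨h1, h2, h3, h4⟩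

end Datum

end Summit.QuantumFields.YangMills.BalabanUVNodes.N07SmallActionBoundaryAvoidance

end
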